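import Summits.BirchSwinnertonDyer.BirchSwinnertonDyer.Theorems.ResidualThetaTransportAtTwoHeckeThetaPartnerAdicAtTwoMatchingAtTwoPrelim
import HarnessLib

/-!
# Matching the cubic character with the embedding at the inert prime `2` (the `(𝓞_k/2)ˣ` dichotomy)

Route `ResidualThetaTransportAtTwo`, crux K0⁺ `HeckeThetaPartnerAdicAtTwo` (stmt-BirchSwinnertonDyer-20690),
helper §D1 of the line "proof from print".  THEOREMS ONLY (no definition, no named fact, no `sorry`).

Setting: `k` a quadratic field in which `2` is inert (`P = (2)` prime, `𝓞_k/P ≅ 𝔽₄`), `e : ℚ̄₂ ≃ ℂ`,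
`σ : k → ℂ`, an odd modulus `𝔪` (coprime to `P`), and a "cubic" multiplicative function `ψ` on the
primes: a ray class character modulo some `𝔪_χ ⊇ (2ᵃ)·𝔪` whose values at the primes `≠ P`, `∤ 𝔪` are
cube roots of unity (the prime-value function of the cubic Hecke character of `ℚ(W[2])/k`).  Write
`S = {b ∈ 𝓞_k : b ≠ 0 odd, b ≡ 1 mod 𝔪}` and read complex numbers `2`-adically through `e`.

**Main result** `exists_matching_pow`: if `ψ̃((b₀)) ≠ 1` for SOME `b₀ ∈ S` (the cubic character is
ramified at `2`, helper §D2), then for `ε = 1` or `ε = 2` and EVERY `b ∈ S`: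
`ψ̃((b))^ε ≡ σ(b)` modulo the maximal ideal of `ℤ̄₂` (`‖e⁻¹(ψ̃((b))^ε) - e⁻¹(σ b)‖ < 1`) — the
MATCHING CONDITION of the Teichmüller twist (`…TeichmullerTwist.exists_isGrossencharakter_congr`) for
`χ^ε`.  Proof (the "canonical character at `2`"): both `F(b) = ψ̃((b)) mod 𝔪_{ℤ̄₂}` and
`G(b) = σ(b) mod 𝔪_{ℤ̄₂}` are multiplicative on `S` and trivial on `b ≡ 1 mod 2` (`F`: `b^{2ᵃ} ≡ 1 mod 𝔪_χ`
and `F³ = 1`; `G`: `σ(1 + 2c) ≡ 1`), so both factor through `(𝓞_k/2)ˣ ≅ ℤ/3`, generated by the class of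
`b₀`; `g = G(b₀)` is a primitive cube root of unity in `𝔽̄₂` (`b₀ ≢ 1 mod 2`), the cube roots of unity
there are `1, g, g²`, and `u = F(b₀) ≠ 1` is one of them: `u = g` gives `ε = 1`, `u = g²` gives `ε = 2`.

References: Serre, *Propriétés galoisiennes des points d'ordre fini des courbes elliptiques*, Invent.
Math. 15 (1972) §1–2 (fundamental characters of level `2` at a supersingular prime); Rohrlich,
Invent. Math. 75 (1984) (canonical Hecke characters).  Only the elementary `(𝓞_k/2)ˣ` bookkeeping is
formalised here.
-/

set_option autoImplicit false
set_option linter.dupNamespace false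

noncomputable section

open scoped NumberField
open NumberField IsDedekindDomain IsLocalRing
open Literature.NumberTheory.GaloisRepresentations Literature.NumberTheory.LFunctions
  Literature.NumberTheory.Automorphic Literature.NumberTheory.EllipticCurves.ModularForms
  Summit.BirchSwinnertonDyer.BirchSwinnertonDyer.Theorems.ThetaLayerLambdaCongruenceAtTwo

namespace Summit.BirchSwinnertonDyer.BirchSwinnertonDyer.Theorems.HeckeThetaPartner

/-! ### The main theorem -/

section Main

variable {k : Type} [Field k] [NumberField k]

/-- **The matching dichotomy at the inert prime `2`.**  See the module docstring.  Hypotheses: `(2)`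
is a prime `P` of `k` of norm `4`; `e : ℚ̄₂ ≃ ℂ`, `σ : k → ℂ`; `𝔪 ≠ 0` coprime to `P`; `ψ` a ray class
character modulo `𝔪_χ ⊇ (2ᵃ)·𝔪` whose values at the primes `≠ P` not dividing `𝔪` are cube roots of
unity; `b₀ ∈ S` with `ψ̃((b₀)) ≠ 1`.  Conclusion: for `ε = 1` or `ε = 2`, every `b ∈ S` has
`‖e⁻¹(ψ̃((b))^ε) - e⁻¹(σ b)‖ < 1`. [cite: SerreInventiones1972, §1.11–§1.13 (supersingular case: level-`2` fundamental characters)] -/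
theorem exists_matching_pow [IsTotallyComplex k] (hk : Module.finrank ℚ k = 2)
    (hp : (Ideal.span {(2 : 𝓞 k)}).IsPrime) (e : PadicAlgCl 2 ≃+* ℂ) (σ : k →+* ℂ)
    {𝔪 : Ideal (𝓞 k)} (h𝔪 : 𝔪 ≠ ⊥) (h𝔪P : IsCoprime 𝔪 (Ideal.span {(2 : 𝓞 k)}))
    (ψ : HeightOneSpectrum (𝓞 k) → ℂ) {𝔪χ : Ideal (𝓞 k)} (hray : IsRayClassCharacter 𝔪χ ψ)
    {a : ℕ} (hle : Ideal.span {(2 : 𝓞 k) ^ a} * 𝔪 ≤ 𝔪χ)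
    (hψ3 : ∀ v : HeightOneSpectrum (𝓞 k), v.asIdeal ≠ Ideal.span {(2 : 𝓞 k)} → ¬ 𝔪 ≤ v.asIdeal →
      ψ v ^ 3 = 1)
    {b₀ : 𝓞 k} (hb₀0 : b₀ ≠ 0) (hb₀P : b₀ ∉ Ideal.span {(2 : 𝓞 k)}) (hb₀𝔪 : b₀ - 1 ∈ 𝔪)
    (hb₀ψ : idealPow k ψ (Ideal.span {b₀}) ≠ 1) :
    ∃ ε : ℕ, (ε = 1 ∨ ε = 2) ∧ ∀ b : 𝓞 k, b ≠ 0 → b ∉ Ideal.span {(2 : 𝓞 k)} → b - 1 ∈ 𝔪 →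
      ‖e.symm (idealPow k ψ (Ideal.span {b}) ^ ε) - e.symm (σ (b : k))‖ < 1 := by
  classical
  /- ── setup: the prime `P = (2)`, its residue field `F = 𝓞_k/P` of order `4` ── -/
  set P : Ideal (𝓞 k) := Ideal.span {(2 : 𝓞 k)} with hPdef
  have hP0 : P ≠ ⊥ := by rw [hPdef, Ne, Ideal.span_singleton_eq_bot]; norm_num
  haveI := hp
  haveI hPmax : P.IsMaximal := hp.isMaximal hP0
  have span_ne_bot : ∀ {b : 𝓞 k}, b ≠ 0 → Ideal.span {b} ≠ ⊥ := fun hb => by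
    rwa [Ne, Ideal.span_singleton_eq_bot]
  have ne_zero_of_notMem : ∀ {b : 𝓞 k}, b ∉ P → b ≠ 0 := fun hb h => hb (h ▸ P.zero_mem)
  have noreal : ∀ (b c : 𝓞 k) (φ : k →+* ℝ), 0 < φ b * φ c := fun _ _ φ => (false_of_ringHom_real φ).elim
  -- coprimality of `(b)` with `𝔪` for `b ≡ 1 mod 𝔪`
  have cop_of_S : ∀ {b : 𝓞 k}, b - 1 ∈ 𝔪 → IsCoprime (Ideal.span {b}) 𝔪 := fun hb => by
    refine isCoprime_span_of_sub_mem ?_ hb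
    exact Ideal.isCoprime_iff_exists.mpr ⟨1, Ideal.mem_span_singleton_self 1, 0, 𝔪.zero_mem, by simp⟩
  /- ── the residue map `ρ` along `e` ── -/
  obtain ⟨ρ, ρ_mul, ρ_one, ρ_pow, ρ_eq_iff, ρ_ne_zero, -⟩ := exists_residueMap e
  /- ── (C) `ψ̃((b))³ = 1` for `b` odd and prime to `𝔪` ── -/
  have cube : ∀ {b : 𝓞 k}, b ≠ 0 → b ∉ P → IsCoprime (Ideal.span {b}) 𝔪 →
      idealPow k ψ (Ideal.span {b}) ^ 3 = 1 := by
    intro b hb0 hbP hb𝔪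
    rw [← idealPow_pow_fun ψ 3 (span_ne_bot hb0)]
    refine idealPow_eq_one_of_forall _ (span_ne_bot hb0) fun v hv => hψ3 v ?_ ?_
    · intro hvP
      exact hbP (hvP ▸ hv (Ideal.mem_span_singleton_self b))
    · exact fun h => (isCoprime_iff_forall_not_le h𝔪).mp hb𝔪 v h hv
  -- hence `ψ̃((b))` is a `2`-adic unit
  have unit_ψ : ∀ {b : 𝓞 k}, b ≠ 0 → b ∉ P → IsCoprime (Ideal.span {b}) 𝔪 →
      ‖e.symm (idealPow k ψ (Ideal.span {b}))‖ = 1 := fun hb0 hbP hb𝔪 =>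
    norm_symm_eq_one_of_pow_eq_one e (by norm_num : 0 < 3) (cube hb0 hbP hb𝔪)
  /- ── (K_F) `ψ̃((x)) = 1` for `x ∈ S` with `x ≡ 1 mod 2` ── -/
  have KF : ∀ {x : 𝓞 k}, x ≠ 0 → x ∉ P → x - 1 ∈ 𝔪 → x - 1 ∈ P → idealPow k ψ (Ideal.span {x}) = 1 := by
    intro x hx0 hxP hx𝔪 hx1
    -- `x^{2^a} ≡ 1 mod 𝔪_χ`
    have h2a : x ^ 2 ^ a - 1 ∈ Ideal.span {(2 : 𝓞 k) ^ a} := by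
      have h := pow_two_pow_sub_one_mem hx1 a
      exact Ideal.span_singleton_le_span_singleton.mpr (pow_dvd_pow 2 (Nat.le_succ a)) h
    have h𝔪' : x ^ 2 ^ a - 1 ∈ 𝔪 := by
      rw [← Ideal.Quotient.eq, map_pow, (Ideal.Quotient.eq).mpr hx𝔪, map_one, one_pow]
    have hχ : x ^ 2 ^ a - 1 ∈ 𝔪χ := by
      apply hle
      have hcop : IsCoprime (Ideal.span {(2 : 𝓞 k) ^ a}) 𝔪 := by
        rw [← Ideal.span_singleton_pow]; exact IsCoprime.pow_left h𝔪P.symm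
      rw [Ideal.mul_eq_inf_of_isCoprime hcop]
      exact ⟨h2a, h𝔪'⟩
    have hpow : idealPow k ψ (Ideal.span {x}) ^ 2 ^ a = 1 := by
      rw [← idealPow_pow ψ (span_ne_bot hx0), Ideal.span_singleton_pow]
      have h := hray.idealPow_span_eq (x ^ 2 ^ a) 1 (pow_ne_zero _ hx0) one_ne_zero
        (Ideal.isCoprime_iff_exists.mpr ⟨1, Ideal.mem_span_singleton_self 1, 0, 𝔪χ.zero_mem, by simp⟩)
        hχ (noreal _ _)
      rw [h, Ideal.span_singleton_one, idealPow_top]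
    have h3 := cube hx0 hxP (cop_of_S hx𝔪)
    have hg : idealPow k ψ (Ideal.span {x}) ^ (2 ^ a).gcd 3 = 1 := pow_gcd_eq_one.mpr ⟨hpow, h3⟩
    rwa [Nat.Coprime.gcd_eq_one (Nat.Coprime.pow_left a (by norm_num)), pow_one] at hg
  /- ── (K_G) `σ(x) ≡ 1` for `x ≡ 1 mod 2` ── -/
  have KG : ∀ {x : 𝓞 k}, x - 1 ∈ P → ρ (σ (x : k)) = 1 := by
    intro x hx1
    rw [← ρ_one, ρ_eq_iff _ _ (norm_symm_embedding_le_one e σ x) (by rw [map_one, norm_one]), map_one]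
    exact norm_symm_embedding_sub_one_lt_one e σ hx1
  /- ── `b₀`: `b₀ ≢ 1 mod 2`, the residues `u = F(b₀)`, `g = G(b₀)` ── -/
  have hb₀cop := cop_of_S hb₀𝔪
  have hb₀1 : b₀ - 1 ∉ P := fun h => hb₀ψ (KF hb₀0 hb₀P hb₀𝔪 h)
  set u := ρ (idealPow k ψ (Ideal.span {b₀})) with hudef
  set g := ρ (σ (b₀ : k)) with hgdef
  -- in `F = 𝓞_k/P`, the class of `b₀` has cube `1`, and every odd `b` is `≡ b₀^j mod P`
  have hcardF : Nat.card (𝓞 k ⧸ P) = 4 := by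
    rw [← Submodule.cardQuot_apply, ← Ideal.absNorm_apply, hPdef, Ideal.absNorm_span_singleton,
      show (2 : 𝓞 k) = algebraMap ℤ (𝓞 k) 2 from by simp, Algebra.norm_algebraMap, RingOfIntegers.rank, hk]
    norm_num
  haveI : Fintype (𝓞 k ⧸ P) := Fintype.ofFinite _
  letI : Field (𝓞 k ⧸ P) := Ideal.Quotient.field P
  have hcardU : Fintype.card (𝓞 k ⧸ P)ˣ = 3 := by
    rw [Fintype.card_units, ← Nat.card_eq_fintype_card, hcardF]
  set gb : (𝓞 k ⧸ P)ˣ := Units.mk0 (Ideal.Quotient.mk P b₀)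
    (by rw [Ne, Ideal.Quotient.eq_zero_iff_mem]; exact hb₀P) with hgbdef
  have hgb3 : gb ^ 3 = 1 := by rw [← hcardU]; exact pow_card_eq_one
  have hb₀3 : b₀ ^ 3 - 1 ∈ P := by
    rw [← Ideal.Quotient.eq, map_pow, map_one]
    have := congrArg (fun x : (𝓞 k ⧸ P)ˣ => (x : 𝓞 k ⧸ P)) hgb3
    simpa [hgbdef] using this
  have hgb1 : gb ≠ 1 := by
    intro h
    have := congrArg (fun x : (𝓞 k ⧸ P)ˣ => (x : 𝓞 k ⧸ P)) h
    simp only [hgbdef, Units.val_mk0, Units.val_one] at this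
    rw [← map_one (Ideal.Quotient.mk P), Ideal.Quotient.eq] at this
    exact hb₀1 this
  -- the three units `1, gb, gb²` exhaust `(𝓞_k/P)ˣ`
  have hexp : ∀ w : (𝓞 k ⧸ P)ˣ, ∃ j : ℕ, j < 3 ∧ w = gb ^ j := by
    have hgb2 : gb ^ 2 ≠ 1 := by
      intro h
      apply hgb1
      have : gb = gb ^ 3 * (gb ^ 2)⁻¹ := by group
      rw [this, hgb3, h, inv_one, one_mul]
    have hgb21 : gb ^ 2 ≠ gb := by
      intro h
      apply hgb1
      have : gb = gb ^ 2 * gb⁻¹ := by group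
      rw [this, h, mul_inv_cancel]
    have hsub : ({1, gb, gb ^ 2} : Finset (𝓞 k ⧸ P)ˣ) = Finset.univ := by
      apply Finset.eq_univ_of_card
      rw [Finset.card_insert_of_notMem, Finset.card_pair hgb21.symm, hcardU]
      simp only [Finset.mem_insert, Finset.mem_singleton, not_or]
      exact ⟨hgb1.symm, hgb2.symm⟩
    intro w
    have hw : w ∈ ({1, gb, gb ^ 2} : Finset (𝓞 k ⧸ P)ˣ) := by rw [hsub]; exact Finset.mem_univ w
    simp only [Finset.mem_insert, Finset.mem_singleton] at hw
    rcases hw with rfl | rfl | rfl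
    · exact ⟨0, by norm_num, by rw [pow_zero]⟩
    · exact ⟨1, by norm_num, by rw [pow_one]⟩
    · exact ⟨2, by norm_num, rfl⟩
  /- ── `F(b) = u^j`, `G(b) = g^j` for `b ∈ S`, `b ≡ b₀^j mod P` ── -/
  have key : ∀ {b : 𝓞 k}, b ≠ 0 → b ∉ P → b - 1 ∈ 𝔪 → ∃ j : ℕ,
      ρ (idealPow k ψ (Ideal.span {b})) = u ^ j ∧ ρ (σ (b : k)) = g ^ j := by
    intro b hb0 hbP hb𝔪
    obtain ⟨j, hj3, hj⟩ := hexp (Units.mk0 (Ideal.Quotient.mk P b)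
      (by rw [Ne, Ideal.Quotient.eq_zero_iff_mem]; exact hbP))
    -- `x = b * b₀^(3 - j) ∈ S`, `x ≡ 1 mod P`
    set x := b * b₀ ^ (3 - j) with hxdef
    have hx0 : x ≠ 0 := mul_ne_zero hb0 (pow_ne_zero _ hb₀0)
    have hxP : x ∉ P := fun h => (hp.mem_or_mem h).elim hbP fun h' => hb₀P (hp.mem_of_pow_mem _ h')
    have hx𝔪 : x - 1 ∈ 𝔪 := by
      rw [← Ideal.Quotient.eq] at hb𝔪 hb₀𝔪 ⊢
      rw [hxdef, map_mul, map_pow, hb𝔪, hb₀𝔪, map_one, one_pow, one_mul]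
    have hx1 : x - 1 ∈ P := by
      rw [← Ideal.Quotient.eq, hxdef, map_mul, map_pow, map_one]
      have hbj : Ideal.Quotient.mk P b = (Ideal.Quotient.mk P b₀) ^ j := by
        have := congrArg (fun x : (𝓞 k ⧸ P)ˣ => (x : 𝓞 k ⧸ P)) hj
        simpa [hgbdef] using this
      have h3 : (Ideal.Quotient.mk P b₀) ^ 3 = 1 := by
        have := congrArg (fun x : (𝓞 k ⧸ P)ˣ => (x : 𝓞 k ⧸ P)) hgb3
        simpa [hgbdef] using this
      rw [hbj, ← pow_add, show j + (3 - j) = 3 by omega, h3]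
    have hFx := KF hx0 hxP hx𝔪 hx1
    have hGx := KG hx1
    -- unfold multiplicativity
    have hspan : Ideal.span {x} = Ideal.span {b} * Ideal.span {b₀} ^ (3 - j) := by
      rw [hxdef, ← Ideal.span_singleton_mul_span_singleton, Ideal.span_singleton_pow]
    rw [hspan, idealPow_mul ψ (span_ne_bot hb0) (pow_ne_zero _ (span_ne_bot hb₀0)),
      idealPow_pow ψ (span_ne_bot hb₀0)] at hFx
    have hu3 : u ^ 3 = 1 := by
      rw [hudef, ← ρ_pow _ (unit_ψ hb₀0 hb₀P hb₀cop).le, cube hb₀0 hb₀P hb₀cop, ρ_one]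
    have hg3 : g ^ 3 = 1 := by
      rw [hgdef, ← ρ_pow _ (norm_symm_embedding_le_one e σ b₀)]
      have hσ3 : σ ((b₀ ^ 3 : 𝓞 k) : k) = σ (b₀ : k) ^ 3 := by push_cast; rw [map_pow]
      rw [← hσ3]
      exact KG hb₀3
    refine ⟨j, ?_, ?_⟩
    · -- `F(b) u^(3-j) = 1`
      have h1 : ρ (idealPow k ψ (Ideal.span {b})) * u ^ (3 - j) = 1 := by
        rw [hudef, ← ρ_pow _ (unit_ψ hb₀0 hb₀P hb₀cop).le,
          ← ρ_mul _ _ (unit_ψ hb0 hbP (cop_of_S hb𝔪)).le (by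
            rw [map_pow, norm_pow, unit_ψ hb₀0 hb₀P hb₀cop, one_pow]), hFx, ρ_one]
      calc ρ (idealPow k ψ (Ideal.span {b}))
          = ρ (idealPow k ψ (Ideal.span {b})) * (u ^ (3 - j) * u ^ j) := by
            rw [← pow_add, show 3 - j + j = 3 by omega, hu3, mul_one]
        _ = u ^ j := by rw [← mul_assoc, h1, one_mul]
    · have h1 : ρ (σ (b : k)) * g ^ (3 - j) = 1 := by
        have hσx : σ ((x : 𝓞 k) : k) = σ (b : k) * σ (b₀ : k) ^ (3 - j) := by
          rw [hxdef]; push_cast; rw [map_mul, map_pow]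
        rw [hgdef, ← ρ_pow _ (norm_symm_embedding_le_one e σ b₀),
          ← ρ_mul _ _ (norm_symm_embedding_le_one e σ b) (by
            rw [map_pow, norm_pow]; exact pow_le_one₀ (norm_nonneg _) (norm_symm_embedding_le_one e σ b₀)),
          ← hσx, hGx]
      calc ρ (σ (b : k)) = ρ (σ (b : k)) * (g ^ (3 - j) * g ^ j) := by
            rw [← pow_add, show 3 - j + j = 3 by omega, hg3, mul_one]
        _ = g ^ j := by rw [← mul_assoc, h1, one_mul]
  /- ── `g` is a primitive cube root of unity, `u ∈ {g, g²}` ── -/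
  have hg3 : g ^ 3 = 1 := by
    rw [hgdef, ← ρ_pow _ (norm_symm_embedding_le_one e σ b₀)]
    have hσ3 : σ ((b₀ ^ 3 : 𝓞 k) : k) = σ (b₀ : k) ^ 3 := by push_cast; rw [map_pow]
    rw [← hσ3]
    exact KG hb₀3
  have hg1 : g ≠ 1 := by
    intro h
    rw [hgdef, ← ρ_one, ρ_eq_iff _ _ (norm_symm_embedding_le_one e σ b₀) (by rw [map_one, norm_one]),
      map_one] at h
    have h1 : ‖e.symm (σ ((b₀ - 1 : 𝓞 k) : k))‖ = 1 :=
      norm_symm_embedding_eq_one_of_not_mem e σ hp hb₀1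
    push_cast at h1
    rw [map_sub, map_one, map_sub, map_one] at h1
    exact absurd h1 h.ne
  have hu3 : u ^ 3 = 1 := by
    rw [hudef, ← ρ_pow _ (unit_ψ hb₀0 hb₀P hb₀cop).le, cube hb₀0 hb₀P hb₀cop, ρ_one]
  have hu1 : u ≠ 1 := by
    intro h
    rw [hudef, ← ρ_one, ρ_eq_iff _ _ (unit_ψ hb₀0 hb₀P hb₀cop).le (by rw [map_one, norm_one]),
      map_one] at h
    have := norm_symm_sub_one_eq_one_of_pow_three e (cube hb₀0 hb₀P hb₀cop) hb₀ψ
    exact absurd this h.ne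
  /- ── conclusion ── -/
  have finish : ∀ (ε : ℕ), u ^ ε = g → ∀ b : 𝓞 k, b ≠ 0 → b ∉ P → b - 1 ∈ 𝔪 →
      ‖e.symm (idealPow k ψ (Ideal.span {b}) ^ ε) - e.symm (σ (b : k))‖ < 1 := by
    intro ε hε b hb0 hbP hb𝔪
    obtain ⟨j, hF, hG⟩ := key hb0 hbP hb𝔪
    have hnorm : ‖e.symm (idealPow k ψ (Ideal.span {b}) ^ ε)‖ ≤ 1 := by
      rw [map_pow, norm_pow, unit_ψ hb0 hbP (cop_of_S hb𝔪), one_pow]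
    rw [← ρ_eq_iff _ _ hnorm (norm_symm_embedding_le_one e σ b),
      ρ_pow _ (unit_ψ hb0 hbP (cop_of_S hb𝔪)).le, hF, hG, ← pow_mul, mul_comm, pow_mul, hε]
  rcases eq_one_or_eq_or_eq_sq_of_pow_three hg3 hg1 hu3 with h | h | h
  · exact absurd h hu1
  · exact ⟨1, Or.inl rfl, finish 1 (by rw [pow_one, h])⟩
  · refine ⟨2, Or.inr rfl, finish 2 ?_⟩
    rw [h, ← pow_mul]
    calc g ^ (2 * 2) = g ^ 3 * g := by ring
      _ = g := by rw [hg3, one_mul]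

end Main

end Summit.BirchSwinnertonDyer.BirchSwinnertonDyer.Theorems.HeckeThetaPartner

end
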